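import Literature.NumberTheory.EllipticCurves.QuadraticTwistLocalPolynomialTwoProofs
import Literature.NumberTheory.EllipticCurves.QuadraticTwistPadicReduction
import Literature.NumberTheory.EllipticCurves.Tamagawa
import Literature.NumberTheory.EllipticCurves.PAdicHeights
import HarnessLib

/-!
# The unramified quadratic twist at a multiplicative `2`: split type and the Kronecker symbol `(D/2)`
# (crux 19357 `GordTwoRankZeroOffCaseOne`, line `three_field_road`, brick «λ₂-flip»; LEAD g17, `--supports` 19357, helper only)

Theorems only (no definition, no named fact, no `sorry`). For an elliptic curve `E/ℚ` with MULTIPLICATIVE reduction at `2` and an integer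
`D ≡ 1 (mod 4)` (so `χ_D` is unramified at `2`), the quadratic twist `E^{(D)}` is again multiplicative at `2`, and it is SPLIT at `2` iff
(`D ≡ 1 (mod 8)` ⟺ `E` is split at `2`): for `D ≡ 1 (mod 8)` (`D` a `2`-adic square) nothing changes, for `D ≡ 5 (mod 8)` (the unramified
non-square class) split and non-split are EXCHANGED — the `2`-adic case of `a₂(E ⊗ χ_D) = χ_D(2)·a₂(E)` with `χ_D(2)` the Kronecker symbol.
This is the place `r = 2` that the E3′ master root-number engine (`TwistRootNumberTwisted.rootNumber_quadraticTwist_eq_of_potMult`, p798928) had to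
exclude by its hypothesis `2 ∣ N_E → D ≡ 1 (mod 8)`; with it the engine runs for every `D ≡ 1 (mod 4)` (file `…TwistRootNumberTwistedKronecker`).

Proof: the tree's `2`-integral twist model `X'_c` of `X^{(1+4c)}` (`QuadraticTwistLocalPolynomialTwoProofs`: `smul_baseChange_twistLiftTwo`,
`isMinimal_baseChange_twistLiftTwo`, `hasMultiplicativeReduction_twistLiftTwo_iff`, `hasSplitMultiplicativeReduction_twistLiftTwo_iff` — the reduction
of `X'_c` is the Artin–Schreier twist of the reduction of `X` by `c̄`, split types agree iff `c̄ ∈ ℘(k)`) applied over `R = ℤ₂` to the minimal model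
`X` of `E ⊗ ℚ₂` with `c = (D − 1)/4`; over `k = 𝔽₂`, `℘(k) = {0}`, so «`c̄ ∈ ℘(k)`» is `2 ∣ c`, i.e. `D ≡ 1 (mod 8)`; model independence of the
reduction type (`hasSplitMultiplicativeReductionAtPrime_iff_of_baseChange_eq_smul`, `hasMultiplicativeReduction_iff_of_isMinimal_of_eq_smul`).

* `residue_padicInt_two_eq_zero`, `sq_add_self_eq_zero_residueField_two` — `𝔽₂` bookkeeping.
* `hasMultiplicativeReductionAtPrime_two_quadraticTwist_of_emod_four` — `E^{(D)}` is multiplicative at `2`.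
* `hasSplitMultiplicativeReductionAtPrime_two_quadraticTwist_iff_of_emod_four` — **split at `2` iff (`D ≡ 1 (8)` ↔ `E` split at `2`)**.

References: [SilvermanAEC2009] VII.5 Prop. 5.1, X.2 Prop. 2.4, Ex. 10.16, App. A Prop. A.1.1; [Knapp1992] Prop. 12.10. BSD is proved for no curve.
presearch: n/a (tree lemma; the DVR statement is the tree's `hasSplitMultiplicativeReduction_twistLiftTwo_iff`).
-/

set_option linter.dupNamespace false
set_option autoImplicit false

noncomputable section

open scoped Classical

open IsLocalRing IsDiscreteValuationRing WeierstrassCurve Literature.NumberTheory.EllipticCurves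

namespace Summit.BirchSwinnertonDyer.BirchSwinnertonDyer.Theorems.TwistRootNumberTwisted

/-! ### `𝔽₂` bookkeeping -/

/-- `2` reduces to `0` in the residue field of `ℤ₂`. [folklore] -/
theorem residue_padicInt_two_eq_zero : residue ℤ_[2] 2 = 0 := by
  have h : residue ℤ_[2] ((2 : ℤ) : ℤ_[2]) = 0 := by
    rw [residue_eq_zero_iff, IsLocalRing.mem_maximalIdeal, PadicInt.mem_nonunits, PadicInt.norm_int_lt_one_iff_dvd]
    norm_num
  simpa using h

/-- The residue field of `ℤ₂` is finite (it is `𝔽₂`). [folklore] -/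
theorem finite_residueField_padicInt_two : Finite (ResidueField ℤ_[2]) :=
  Finite.of_equiv (ZMod 2) (PadicInt.residueField (p := 2)).symm.toEquiv

/-- In `𝔽₂ = ℤ₂/2` every element satisfies `z² + z = 0` (`℘(𝔽₂) = {0}`). [folklore] -/
theorem sq_add_self_eq_zero_residueField_two (z : ResidueField ℤ_[2]) : z ^ 2 + z = 0 := by
  apply (PadicInt.residueField (p := 2)).injective
  rw [map_add, map_pow, map_zero]
  generalize (PadicInt.residueField (p := 2)) z = w
  revert w
  decide

/-- For an integer `c`, «`c̄ ∈ ℘(𝔽₂)`» (`∃ z, z² + z = c̄` in the residue field of `ℤ₂`) iff `2 ∣ c`. [folklore] -/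
theorem exists_sq_add_self_eq_residue_iff_two_dvd (c : ℤ) :
    (∃ z : ResidueField ℤ_[2], z ^ 2 + z = residue ℤ_[2] (c : ℤ_[2])) ↔ (2 : ℤ) ∣ c := by
  constructor
  · rintro ⟨z, hz⟩
    rw [sq_add_self_eq_zero_residueField_two z] at hz
    have h0 : residue ℤ_[2] (c : ℤ_[2]) = 0 := hz.symm
    rw [residue_eq_zero_iff, IsLocalRing.mem_maximalIdeal, PadicInt.mem_nonunits, PadicInt.norm_int_lt_one_iff_dvd] at h0
    exact_mod_cast h0
  · intro hc
    refine ⟨0, ?_⟩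
    rw [sq_add_self_eq_zero_residueField_two 0, eq_comm, residue_eq_zero_iff, IsLocalRing.mem_maximalIdeal, PadicInt.mem_nonunits,
      PadicInt.norm_int_lt_one_iff_dvd]
    exact_mod_cast hc

/-! ### The twist at a multiplicative `2` -/

variable (E : WeierstrassCurve ℚ) [E.IsElliptic]

/-- **The unramified quadratic twist at a multiplicative `2`** (both clauses at once). For `E/ℚ` multiplicative at `2` and `D ≡ 1 (mod 4)`:
`E^{(D)}` is multiplicative at `2`, and it is split at `2` iff (`D ≡ 1 (mod 8)` ↔ `E` is split at `2`). Proof through the tree's `2`-integral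
twist model `X'_c`, `c = (D−1)/4`, of the minimal model `X` of `E ⊗ ℚ₂` (its reduction is the Artin–Schreier twist of `X̄` by `c̄`; `℘(𝔽₂) = {0}`).
[cite: SilvermanAEC2009, VII.5 Prop. 5.1 (b), X.2 Prop. 2.4 and Ex. 10.16, App. A Prop. A.1.1] -/
theorem hasMultiplicativeReductionAtPrime_two_quadraticTwist_and_split_iff_of_emod_four
    {D : ℤ} (hD4 : D % 4 = 1) (hmult : E.HasMultiplicativeReductionAtPrime 2) :
    (E.quadraticTwist (D : ℚ)).HasMultiplicativeReductionAtPrime 2 ∧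
      ((E.quadraticTwist (D : ℚ)).HasSplitMultiplicativeReductionAtPrime 2 ↔
        (D % 8 = 1 ↔ E.HasSplitMultiplicativeReductionAtPrime 2)) := by
  haveI : Fact (Nat.Prime 2) := ⟨Nat.prime_two⟩
  haveI : Finite (ResidueField ℤ_[2]) := finite_residueField_padicInt_two
  have hk : residue ℤ_[2] 2 = 0 := residue_padicInt_two_eq_zero
  have hD0 : (D : ℚ) ≠ 0 := by
    have : D ≠ 0 := by rintro rfl; simp at hD4
    exact_mod_cast this
  haveI : (E.quadraticTwist (D : ℚ)).IsElliptic := E.isElliptic_quadraticTwist hD0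
  -- `c = (D - 1)/4`, `1 + 4c = D`
  set c : ℤ := (D - 1) / 4 with hc
  have hcD : 1 + 4 * c = D := by omega
  have hcZ : (1 + 4 * (c : ℤ_[2]) : ℤ_[2]) = ((D : ℤ) : ℤ_[2]) := by rw [← hcD]; push_cast; ring
  have hcK : algebraMap ℤ_[2] ℚ_[2] (1 + 4 * (c : ℤ_[2])) = ((D : ℚ) : ℚ_[2]) := by
    rw [hcZ, map_intCast]; norm_cast
  -- the minimal model `X` of `E ⊗ ℚ₂`
  set X : WeierstrassCurve ℚ_[2] := (E.baseChange ℚ_[2]).minimal ℤ_[2] with hX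
  have hXdef : X = ((E.baseChange ℚ_[2]).exists_isMinimal ℤ_[2]).choose • E.baseChange ℚ_[2] := rfl
  haveI : (E.baseChange ℚ_[2]).IsElliptic := inferInstanceAs (E.map (algebraMap ℚ ℚ_[2])).IsElliptic
  haveI hXell : X.IsElliptic := by rw [hXdef]; infer_instance
  have hXΔ : X.Δ ≠ 0 := X.isUnit_Δ.ne_zero
  have hmultX : X.HasMultiplicativeReduction ℤ_[2] := hmult
  -- the `2`-integral twist model `T` of `X^{(D)}` (the tree's `X'_c`), minimal, `K`-isomorphic to `X^{(D)}`
  set T : WeierstrassCurve ℤ_[2] :=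
    (⟨(WeierstrassCurve.integralModel ℤ_[2] X).a₁,
      (c : ℤ_[2]) * (WeierstrassCurve.integralModel ℤ_[2] X).a₁ ^ 2 + (1 + 4 * (c : ℤ_[2])) * (WeierstrassCurve.integralModel ℤ_[2] X).a₂,
      (1 + 4 * (c : ℤ_[2])) * (WeierstrassCurve.integralModel ℤ_[2] X).a₃,
      2 * (1 + 4 * (c : ℤ_[2])) * (c : ℤ_[2]) * (WeierstrassCurve.integralModel ℤ_[2] X).a₁ * (WeierstrassCurve.integralModel ℤ_[2] X).a₃ +
        (1 + 4 * (c : ℤ_[2])) ^ 2 * (WeierstrassCurve.integralModel ℤ_[2] X).a₄,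
      (1 + 4 * (c : ℤ_[2])) ^ 2 * (c : ℤ_[2]) * (WeierstrassCurve.integralModel ℤ_[2] X).a₃ ^ 2 +
        (1 + 4 * (c : ℤ_[2])) ^ 3 * (WeierstrassCurve.integralModel ℤ_[2] X).a₆⟩ : WeierstrassCurve ℤ_[2]) with hT
  haveI hTmin : IsMinimal ℤ_[2] (T.baseChange ℚ_[2]) := isMinimal_baseChange_twistLiftTwo ℤ_[2] hk X (c : ℤ_[2])
  have hsm := smul_baseChange_twistLiftTwo ℤ_[2] X (c : ℤ_[2])
  rw [hcK] at hsm
  -- `hsm : Cv • T ⊗ ℚ₂ = X^{(D)}`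
  have hmultT : (T.baseChange ℚ_[2]).HasMultiplicativeReduction ℤ_[2] :=
    (hasMultiplicativeReduction_twistLiftTwo_iff ℤ_[2] hk).mpr hmultX
  haveI hTell : (T.baseChange ℚ_[2]).IsElliptic := by
    rw [isElliptic_iff, Δ_baseChange_twistLiftTwo, hcK]
    exact ((isUnit_iff_ne_zero.mpr (by exact_mod_cast hD0)).pow 6).mul X.isUnit_Δ
  have hTΔ : (T.baseChange ℚ_[2]).Δ ≠ 0 := (T.baseChange ℚ_[2]).isUnit_Δ.ne_zero
  -- `E^{(D)} ⊗ ℚ₂ = C • (T ⊗ ℚ₂)`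
  obtain ⟨C, hC⟩ : ∃ C : VariableChange ℚ_[2], (E.quadraticTwist (D : ℚ)).baseChange ℚ_[2] = C • T.baseChange ℚ_[2] := by
    set C₀ := ((E.baseChange ℚ_[2]).exists_isMinimal ℤ_[2]).choose with hC₀
    set Cv : VariableChange ℚ_[2] := ⟨1, 0, -X.a₁ / 2, -((D : ℚ) : ℚ_[2]) * X.a₃ / 2⟩ with hCv
    have h1 : (E.quadraticTwist (D : ℚ)).baseChange ℚ_[2] = (E.baseChange ℚ_[2]).quadraticTwist ((D : ℚ) : ℚ_[2]) := by
      rw [baseChange, map_quadraticTwist, baseChange]; simp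
    have h2 : E.baseChange ℚ_[2] = C₀⁻¹ • X := by rw [hXdef, inv_smul_smul]
    refine ⟨(⟨C₀⁻¹.u, ((D : ℚ) : ℚ_[2]) * C₀⁻¹.r, 0, 0⟩ : VariableChange ℚ_[2]) * Cv, ?_⟩
    rw [h1, h2, quadraticTwist_smul, mul_smul, hsm]
  refine ⟨?_, ?_⟩
  · -- multiplicative: model independence against the minimal `T ⊗ ℚ₂`
    change (((E.quadraticTwist (D : ℚ)).baseChange ℚ_[2]).minimal ℤ_[2]).HasMultiplicativeReduction ℤ_[2]
    have hmin : ((E.quadraticTwist (D : ℚ)).baseChange ℚ_[2]).minimal ℤ_[2] =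
        ((((E.quadraticTwist (D : ℚ)).baseChange ℚ_[2]).exists_isMinimal ℤ_[2]).choose * C) • T.baseChange ℚ_[2] := by
      rw [mul_smul, ← hC]; rfl
    exact (hasMultiplicativeReduction_iff_of_isMinimal_of_eq_smul ℤ_[2] hmin hTΔ).mpr hmultT
  · -- split type: `E^{(D)}` split ↔ `T` split ↔ (`c̄ ∈ ℘(𝔽₂)` ↔ `X` split) ↔ (`D ≡ 1 (8)` ↔ `E` split)
    rw [hasSplitMultiplicativeReductionAtPrime_iff_of_baseChange_eq_smul hC hTΔ,
      hasSplitMultiplicativeReduction_twistLiftTwo_iff ℤ_[2] hk hmultX, exists_sq_add_self_eq_residue_iff_two_dvd]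
    have h8 : (2 : ℤ) ∣ c ↔ D % 8 = 1 := by omega
    rw [h8]
    rfl

/-- **`E^{(D)}` is multiplicative at `2`** (`E` multiplicative at `2`, `D ≡ 1 (mod 4)`). [cite: SilvermanAEC2009, VII.5 Prop. 5.1 (b)] -/
theorem hasMultiplicativeReductionAtPrime_two_quadraticTwist_of_emod_four
    {D : ℤ} (hD4 : D % 4 = 1) (hmult : E.HasMultiplicativeReductionAtPrime 2) :
    (E.quadraticTwist (D : ℚ)).HasMultiplicativeReductionAtPrime 2 :=
  (hasMultiplicativeReductionAtPrime_two_quadraticTwist_and_split_iff_of_emod_four E hD4 hmult).1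

/-- **Split type of `E^{(D)}` at a multiplicative `2`**: split iff (`D ≡ 1 (mod 8)` ↔ `E` split) — unchanged for `D ≡ 1 (8)`, FLIPPED for
`D ≡ 5 (8)` (the Kronecker symbol `(D/2) = −1`). [cite: SilvermanAEC2009, X.2 Prop. 2.4 and Ex. 10.16, App. A Prop. A.1.1] -/
theorem hasSplitMultiplicativeReductionAtPrime_two_quadraticTwist_iff_of_emod_four
    {D : ℤ} (hD4 : D % 4 = 1) (hmult : E.HasMultiplicativeReductionAtPrime 2) :
    (E.quadraticTwist (D : ℚ)).HasSplitMultiplicativeReductionAtPrime 2 ↔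
      (D % 8 = 1 ↔ E.HasSplitMultiplicativeReductionAtPrime 2) :=
  (hasMultiplicativeReductionAtPrime_two_quadraticTwist_and_split_iff_of_emod_four E hD4 hmult).2

/-- The flip, spelled out: for `D ≡ 5 (mod 8)`, `E^{(D)}` is split at `2` iff `E` is NOT. [cite: SilvermanAEC2009, Ex. 10.16] -/
theorem hasSplitMultiplicativeReductionAtPrime_two_quadraticTwist_iff_not_of_emod_eight_eq_five
    {D : ℤ} (hD8 : D % 8 = 5) (hmult : E.HasMultiplicativeReductionAtPrime 2) :
    (E.quadraticTwist (D : ℚ)).HasSplitMultiplicativeReductionAtPrime 2 ↔ ¬ E.HasSplitMultiplicativeReductionAtPrime 2 := by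
  rw [hasSplitMultiplicativeReductionAtPrime_two_quadraticTwist_iff_of_emod_four E (by omega) hmult]
  constructor
  · intro h hs; have := h.mpr hs; omega
  · intro h; exact ⟨fun h8 ↦ by omega, fun hs ↦ absurd hs h⟩

end Summit.BirchSwinnertonDyer.BirchSwinnertonDyer.Theorems.TwistRootNumberTwisted

end
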